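import Summits.QuantumFields.QCD.Theses.PauliWegnerSea
import Literature.MathematicalPhysics.QuantumFieldTheory.QCDTimeReflection

/-!
# Line `gamma5-square-positivity` — checked skeleton for crux stmt-QuantumFields-11512
(`Summit.QuantumFields.QCD.Theses.PauliWegnerSea.FMClosureUnquenched`, K2 of route PauliWegnerSea)

Crux (K2): `FibreCofactorDomination → TiltedFlatness → ∀ N_f reg m > 0, INPUT (one-scale shell) → CONCL`
(clause (ii) of `MobilityGap`: phase-quenched fractional-moment decay `≤ C e^{-δ a_k ‖v‖}` from `‖v‖ = 0` on,
`k`- and volume-uniform `C`).  Refuter findings A6/B0 (+ `Disproof.lean` §5 `not_abstractFMClosureRepaired`): with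
the shell at logarithmic scale the typed conclusion demands smallness INSIDE the shell, which no outward bootstrap
delivers — every proof of K2 as typed contains an INWARD interpolation principle; B1: the only generic one is
reflection-positivity log-convexity, available for even `N_f` with pairwise-degenerate masses `> -1`, ANTIPERIODIC
time, `β ≥ 0`.

Line (idea card `gamma5-square-positivity`, ideator 3, merged by triage r1-{1,2,3} with `transfer-logconvex-inward`):
the γ₅-SQUARE POSITIVITY SANDWICH.  On the paired locus the tilt `Π_f |det D_f|` is honest and the phase-quenched
SECOND moment `Σ|G_f(0,v)|²` is the charged-pion correlator of the auxiliary ANTIPERIODIC theory, hence (Lüscher's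
positive transfer matrix) (α) bounded by ONE constant `A(η)` for all `β ≥ 0`, volumes and endpoints — the
`k`-, `S`-uniform short-distance a-priori bound that `K1 + K3` do not give (A7) — `stub_pionApriori`; (β) log-convex
along the time axis and dominated by the axis — `stub_pionSpectral`.  The fractional moment sits below the second
moment (Jensen) and the second moment is within Hölder reach of it through a `(2+ε)`-moment that the sea pays for
(`‖adj‖^{2+ε}|det|^{-ε}`), POLYNOMIAL in `(1+β_k)` and the side — `stub_tiltedMoment`; log-convexity turns outward
smallness on the axis into inward decay with the a-priori constant as prefactor, the polynomial losses being absorbed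
by sliding the anchor outwards (`a_k S ≫ log S + log β_k`) — `stub_inwardSandwich`; the statement's own periodic tori
are reached through the antipodal seam, paid with winding-path smallness at the volume scale — `stub_seam`.  The
OUTWARD half (decay for `‖v‖ ≥ ℓ(k)`) is consumed as `stub_outward` (the subject of the outward lines
`thick-collar-far-stability` / `sea-factorises-across-collars`).  Off the reflection-positive locus (odd `N_f`,
unpaired masses, masses `≤ -1` i.o., negative or super-logarithmic `β_k`, volumes `a_kL_k = O(log 1/a_k)`) NO inward
mechanism is known (B0 + B1): the corresponding step is the declared, registered gap `stub_inwardOffLocus` — the line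
does NOT claim it; its recommendation (all three triagers) is the A6 restatement of (ii) / restriction of K2's range,
under which that stub is vacuous.

`composition_closed` (stub statements ⇒ crux, by cases on `RPLocus`) and `concl_of_rpLocus` (the positivity branch)
are sorry-free; `FMClosureUnquenched_of` concludes the crux BY NAME from the seven sorried `stub_*` and nothing else;
`fmClosure_iff` certifies that the packaging defs are verbatim (`Iff.rfl`).

Disproof used: `Disproof.lean` (cdisprove cycles 1–1c) is not mounted on this seat; from its evidence notes: the crux is
`K1 → K3 → Core` (`fmClosure_iff`, mirrored here), §5 `not_abstractFMClosureRepaired` (inward smallness is demanded: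
answered by `stub_inwardSandwich` on the RP locus, declared open in `stub_inwardOffLocus` off it), §6 `outward_bootstrap`
(what `stub_outward` abstracts), `core_imp_nnCriterion` (A5 unit-shell corner: inherited unchanged by `stub_outward`;
the `2 ≤ ℓ₀` repair is route-level).  No landed `Negative/` lemma exists for this crux (Theorems/ has none), so no stub
can instantiate one.

Revision (crux-plan gen 2, same unit): stub set, names and composition unchanged; two sharpenings.  (1) The axis
DOMINATION clause (b) of `stub_pionSpectral` / `SpectralAlong` now carries the guard `1 ≤ |v₀|`: the Cauchy–Schwarz
argument lives in the pairing `Tr(𝕋^(N-t) X 𝕋^t Y†)`, i.e. in the spectral representation of the pion correlator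
between DISTINCT time slices `1 ≤ t ≤ N-1` — the same range that restricts (a) to `2 ≤ t ≤ 2S-1` and that the tree's
predicate `QCDSiteReflectionPositivity` uses (observables in the slices `1 … ⌊S/2⌋`, nothing on the reflection plane);
the equal-time case `v = (0, x⃗)`, `x⃗ ≠ 0` is neither covered by it (Wilson fermions: the `t = 0` bilinear mixes the two
half-algebras) nor needed — `stub_inwardSandwich` dominates only TIME-LIKE endpoints `|v₀| = ‖v‖ ≥ 1` (`v = 0` needs no
domination).  Strictly weaker stub, identical composition.  (2) `stub_tiltedMoment` is given a second, K1-FREE route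
in its docstring (`Y ≤ 144/σ_min(D_f)` reduces it to a `det²`-assisted spectral small-ball bound under the honest paired
measure), so the stub no longer silently contains the antiperiodic twin of the open rank-2 crux `FibreCofactorDomination`.
-/

namespace Summit.QuantumFields.QCD.Cruxes.FMClosureUnquenched.Gamma5SquarePositivity

open scoped BigOperators
open MeasureTheory Filter Literature.MathematicalPhysics.QuantumFieldTheory
  Literature.MathematicalPhysics.QuantumLattice Literature.Probability.LatticeModels

noncomputable section

/-! ### §0 Packaging — verbatim copies of the crux's clause texts (`fmClosure_iff` is `Iff.rfl`) -/

/-- The PHASE-QUENCHED FRACTIONAL MOMENT of the flavour-`f` quark propagator from the origin to `v` on the torus of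
side `2S+1` (time-PERIODIC quarks: the crux's own `diracMatrix`), at inverse coupling `β`, bare masses `mq`,
exponent `s` — VERBATIM the quotient of Bochner integrals of clause (ii) / of the one-scale input (with `s = 2` it is the
second moment, with `s = 2 + ε` the higher moment; real `rpow` throughout). -/
def perMoment {Nf : ℕ} (β : ℝ) (S : ℕ) (mq : Fin Nf → ℝ) (s : ℝ) (f : Fin Nf) (v : Literature.Probability.LatticeModels.Site 4) : ℝ :=
  (∫ U : GaugeConfig 4 (2 * S + 1) (Matrix.specialUnitaryGroup (Fin 3) ℂ), ‖(diracMatrix U mq).det‖ * (∑ a : Fin 3, ∑ i : Fin 4, ∑ b : Fin 3, ∑ j : Fin 4, ‖(diracMatrix U mq)⁻¹ (quarkEquiv (f, (Torus.proj (2 * S + 1) 0, a, i))) (quarkEquiv (f, (Torus.proj (2 * S + 1) v, b, j)))‖) ^ s ∂(wilsonMeasure (fundamentalRep (Fin 3)) β)) / (∫ U : GaugeConfig 4 (2 * S + 1) (Matrix.specialUnitaryGroup (Fin 3) ℂ), ‖(diracMatrix U mq).det‖ ∂(wilsonMeasure (fundamentalRep (Fin 3)) β))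

/-- The same moment in the auxiliary theory with time-ANTIPERIODIC quarks (the tree's `diracMatrixAP`: the sign layer
`t = S → S+1`, antipodal to the origin — `QCDTimeReflection.lean`), tilted by `‖det D_AP‖`: on the paired-mass locus
`‖det D_AP‖ = det D_AP` (a product of squares), so this is an HONEST expectation of the transfer-matrix (trace)
functional, and at `s = 2` it is the charged-pion two-point function `-⟨P_ff'(0) P_f'f(v)⟩_AP`
(`γ₅`-hermiticity: `Σ|G_f(0,v)|² = tr G_f(0,v) γ₅ G_f'(v,0) γ₅` — the "γ₅-square"). -/
def apMoment {Nf : ℕ} (β : ℝ) (S : ℕ) (mq : Fin Nf → ℝ) (s : ℝ) (f : Fin Nf) (v : Literature.Probability.LatticeModels.Site 4) : ℝ :=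
  (∫ U : GaugeConfig 4 (2 * S + 1) (Matrix.specialUnitaryGroup (Fin 3) ℂ), ‖(diracMatrixAP U mq).det‖ * (∑ a : Fin 3, ∑ i : Fin 4, ∑ b : Fin 3, ∑ j : Fin 4, ‖(diracMatrixAP U mq)⁻¹ (quarkEquiv (f, (Torus.proj (2 * S + 1) 0, a, i))) (quarkEquiv (f, (Torus.proj (2 * S + 1) v, b, j)))‖) ^ s ∂(wilsonMeasure (fundamentalRep (Fin 3)) β)) / (∫ U : GaugeConfig 4 (2 * S + 1) (Matrix.specialUnitaryGroup (Fin 3) ℂ), ‖(diracMatrixAP U mq).det‖ ∂(wilsonMeasure (fundamentalRep (Fin 3)) β))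

/-- The ONE-SCALE INPUT of the crux for `(reg, m)` — verbatim. -/
def Input {Nf : ℕ} (reg : QCDRegularisation Nf) (m : Fin Nf → ℝ) : Prop :=
  ∀ q : ℕ, ∃ K₀ s : ℝ, 0 < s ∧ s < 1 ∧ ∀ᶠ k in atTop, ∃ ℓ₀ : ℕ, 1 ≤ ℓ₀ ∧ ℓ₀ ≤ reg.L k ∧ (ℓ₀ : ℝ) * reg.a k ≤ K₀ * (1 + |Real.log (reg.a k)|) ∧ ∀ S : ℕ, reg.L k ≤ S → ∀ (f : Fin Nf) (v : Literature.Probability.LatticeModels.Site 4), v ∈ box 4 S → ‖v‖ = (ℓ₀ : ℝ) → (ℓ₀ : ℝ) ^ q * (1 + |reg.β k|) ^ q * (perMoment (reg.β k) S (fun fl => reg.mcrit k + reg.a k * m fl / reg.Zm k) s f v) ≤ 1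

/-- Clause (ii) of `MobilityGap` for `(reg, m)` — the crux's conclusion, verbatim. -/
def Concl {Nf : ℕ} (reg : QCDRegularisation Nf) (m : Fin Nf → ℝ) : Prop :=
  ∃ s δ C : ℝ, 0 < s ∧ s < 1 ∧ 0 < δ ∧ ∀ᶠ k in atTop, ∀ S : ℕ, reg.L k ≤ S → ∀ (f : Fin Nf) (v : Literature.Probability.LatticeModels.Site 4), v ∈ box 4 S → perMoment (reg.β k) S (fun fl => reg.mcrit k + reg.a k * m fl / reg.Zm k) s f v ≤ C * Real.exp (-(δ * (reg.a k * ‖v‖)))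

/-- OUTWARD DECAY with exposed constants: clause (ii) restricted to `‖v‖ ≥ ℓ(k)` for SOME threshold `ℓ(k)` of at most
logarithmic scale, `ℓ(k) a_k ≤ K₁ (1 + |log a_k|)`, with ONE `k`- and volume-uniform prefactor `C > 0`
(= refuter A6's second reading of (ii); what every outward bootstrap delivers). -/
def OutwardWith {Nf : ℕ} (reg : QCDRegularisation Nf) (m : Fin Nf → ℝ) (s δ C K₁ : ℝ) : Prop :=
  ∀ᶠ k in atTop, ∃ ℓ : ℕ, (ℓ : ℝ) * reg.a k ≤ K₁ * (1 + |Real.log (reg.a k)|) ∧ ∀ S : ℕ, reg.L k ≤ S →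
    ∀ (f : Fin Nf) (v : Literature.Probability.LatticeModels.Site 4), v ∈ box 4 S → (ℓ : ℝ) ≤ ‖v‖ →
      perMoment (reg.β k) S (fun fl => reg.mcrit k + reg.a k * m fl / reg.Zm k) s f v ≤ C * Real.exp (-(δ * (reg.a k * ‖v‖)))

/-- The OUTWARD HALF of clause (ii) for `(reg, m)`. -/
def Outward {Nf : ℕ} (reg : QCDRegularisation Nf) (m : Fin Nf → ℝ) : Prop :=
  ∃ s δ C K₁ : ℝ, 0 < s ∧ s < 1 ∧ 0 < δ ∧ 0 < C ∧ OutwardWith reg m s δ C K₁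

/-- PAIRED masses: a fixed-point-free involution of the flavours preserving the tuple (even `N_f`, pairwise
degenerate) — `Π_f det D_W(m_f) = Π_pairs det² ≥ 0`, phase-quenched = honest. -/
def Paired {Nf : ℕ} (mq : Fin Nf → ℝ) : Prop :=
  ∃ σ : Equiv.Perm (Fin Nf), (∀ f, σ f ≠ f) ∧ (∀ f, σ (σ f) = f) ∧ ∀ f, mq (σ f) = mq f

/-- MASS WINDOW: every bare trajectory stays eventually `η` inside Lüscher's positivity domain `m₀ > -1`
(`κ < 1/6`, `r = 1`). -/
def MassWindow {Nf : ℕ} (reg : QCDRegularisation Nf) (m : Fin Nf → ℝ) (η : ℝ) : Prop :=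
  ∀ f : Fin Nf, ∀ᶠ k in atTop, -1 + η ≤ reg.mcrit k + reg.a k * m f / reg.Zm k

/-- TAME COUPLING: `0 ≤ β_k ≤ B₀ (1 + |log a_k|)` eventually (reflection positivity of the gauge weight needs `β ≥ 0`;
the upper bound — true on every asymptotically free trajectory, `β_k ≈ 4b₀|log a_k|` — keeps the `(1+β_k)^p` losses
of the tilted moment bound below the outward smallness at the volume scale). -/
def TameCoupling {Nf : ℕ} (reg : QCDRegularisation Nf) : Prop :=
  ∃ B₀ : ℝ, ∀ᶠ k in atTop, 0 ≤ reg.β k ∧ reg.β k ≤ B₀ * (1 + |Real.log (reg.a k)|)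

/-- LARGE VOLUME: `a_k L_k / (1 + |log a_k|) → ∞` (the scheme volume beats the logarithmic shell scale; needed to keep
the antiperiodic seam — at time `±S`, `S ≥ L_k` — far outside the inward window `‖v‖ < ℓ(k)`; `QCDRegularisation`
itself only has `a_k L_k → ∞`, triage r1-1 (b) / r1-3 (b)). -/
def LargeVolume {Nf : ℕ} (reg : QCDRegularisation Nf) : Prop :=
  Tendsto (fun k => reg.a k * reg.L k / (1 + |Real.log (reg.a k)|)) atTop atTop

/-- The REFLECTION-POSITIVE LOCUS of the crux's parameters `(reg, m)` — the scope of the positivity half. -/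
def RPLocus {Nf : ℕ} (reg : QCDRegularisation Nf) (m : Fin Nf → ℝ) : Prop :=
  Paired m ∧ (∃ η : ℝ, 0 < η ∧ MassWindow reg m η) ∧ TameCoupling reg ∧ LargeVolume reg

/-- A-PRIORI BOUND along `reg`: the antiperiodic second moment is bounded by ONE constant, all `k` (eventually), all
volumes `S ≥ 1`, flavours and endpoints. -/
def AprioriAlong {Nf : ℕ} (reg : QCDRegularisation Nf) (m : Fin Nf → ℝ) (A : ℝ) : Prop :=
  ∀ᶠ k in atTop, ∀ S : ℕ, 1 ≤ S → ∀ (f : Fin Nf) (v : Literature.Probability.LatticeModels.Site 4), v ∈ box 4 S → apMoment (reg.β k) S (fun fl => reg.mcrit k + reg.a k * m fl / reg.Zm k) 2 f v ≤ A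

/-- SPECTRAL SHAPE along `reg`: (a) three-point log-convexity of the antiperiodic second moment along the time axis on
`2 ≤ t ≤ 2S-1`; (b) domination of every endpoint OFF THE TIME-ZERO SLICE (`1 ≤ |v₀|`) by the time-axis point at the
same `|v₀|` (gen 2: the equal-time case is neither needed downstream nor covered by the spectral representation). -/
def SpectralAlong {Nf : ℕ} (reg : QCDRegularisation Nf) (m : Fin Nf → ℝ) : Prop :=
  ∀ᶠ k in atTop, ∀ S : ℕ, 1 ≤ S → ∀ f : Fin Nf,
    (∀ t : ℕ, 2 ≤ t → t + 2 ≤ 2 * S + 1 →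
      apMoment (reg.β k) S (fun fl => reg.mcrit k + reg.a k * m fl / reg.Zm k) 2 f (Pi.single 0 ((t : ℕ) : ℤ)) ^ 2 ≤ apMoment (reg.β k) S (fun fl => reg.mcrit k + reg.a k * m fl / reg.Zm k) 2 f (Pi.single 0 ((t - 1 : ℕ) : ℤ)) * apMoment (reg.β k) S (fun fl => reg.mcrit k + reg.a k * m fl / reg.Zm k) 2 f (Pi.single 0 ((t + 1 : ℕ) : ℤ))) ∧
    (∀ v : Literature.Probability.LatticeModels.Site 4, v ∈ box 4 S → 1 ≤ |v 0| → apMoment (reg.β k) S (fun fl => reg.mcrit k + reg.a k * m fl / reg.Zm k) 2 f v ≤ apMoment (reg.β k) S (fun fl => reg.mcrit k + reg.a k * m fl / reg.Zm k) 2 f (Pi.single 0 |v 0|))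

/-- TILTED HIGHER MOMENT along `reg`: the antiperiodic `(2+ε)`-moment is a genuine (integrable) Bochner integral and is
bounded POLYNOMIALLY in `(1 + β_k)` and in the side `2S+1`. -/
def MomentAlong {Nf : ℕ} (reg : QCDRegularisation Nf) (m : Fin Nf → ℝ) (ε p Cm : ℝ) : Prop :=
  ∀ᶠ k in atTop, ∀ S : ℕ, 1 ≤ S → ∀ (f : Fin Nf) (v : Literature.Probability.LatticeModels.Site 4), v ∈ box 4 S →
    Integrable (fun U : GaugeConfig 4 (2 * S + 1) (Matrix.specialUnitaryGroup (Fin 3) ℂ) => ‖(diracMatrixAP U (fun fl => reg.mcrit k + reg.a k * m fl / reg.Zm k)).det‖ * (∑ a : Fin 3, ∑ i : Fin 4, ∑ b : Fin 3, ∑ j : Fin 4, ‖(diracMatrixAP U (fun fl => reg.mcrit k + reg.a k * m fl / reg.Zm k))⁻¹ (quarkEquiv (f, (Torus.proj (2 * S + 1) 0, a, i))) (quarkEquiv (f, (Torus.proj (2 * S + 1) v, b, j)))‖) ^ (2 + ε)) (wilsonMeasure (fundamentalRep (Fin 3)) (reg.β k)) ∧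
    apMoment (reg.β k) S (fun fl => reg.mcrit k + reg.a k * m fl / reg.Zm k) (2 + ε) f v ≤ Cm * (1 + reg.β k) ^ p * ((2 * S + 1 : ℕ) : ℝ) ^ p

/-- SEAM, inward direction: inside half the volume every periodic moment is controlled by the antiperiodic moment at a
TIME-LIKE endpoint of the same sup-norm (cubic symmetry of the periodic ensemble + winding-path comparison), up to an
additive error decaying at the volume scale. -/
def SeamNear {Nf : ℕ} (reg : QCDRegularisation Nf) (m : Fin Nf → ℝ) (s C₁ δ₁ : ℝ) : Prop :=
  ∀ᶠ k in atTop, ∀ S : ℕ, reg.L k ≤ S → ∀ (f : Fin Nf) (v : Literature.Probability.LatticeModels.Site 4), v ∈ box 4 S → 2 * ‖v‖ ≤ (S : ℝ) →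
    ∃ v' : Literature.Probability.LatticeModels.Site 4, v' ∈ box 4 S ∧ ‖v'‖ = ‖v‖ ∧ ((|v' 0| : ℤ) : ℝ) = ‖v'‖ ∧
      perMoment (reg.β k) S (fun fl => reg.mcrit k + reg.a k * m fl / reg.Zm k) s f v ≤
        C₁ * apMoment (reg.β k) S (fun fl => reg.mcrit k + reg.a k * m fl / reg.Zm k) s f v' + C₁ * Real.exp (-(δ₁ * (reg.a k * S)))

/-- FAR-AXIS SMALLNESS along `reg` (seam, outward direction, fed by `OutwardWith`): on the time axis, between the
outward threshold and half the volume, the antiperiodic `s`-moment is exponentially small at the outward rate, up to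
the volume-scale seam error. -/
def FarAxisAlong {Nf : ℕ} (reg : QCDRegularisation Nf) (m : Fin Nf → ℝ) (s δ C₂ δ₁ K₁ : ℝ) : Prop :=
  ∀ᶠ k in atTop, ∃ ℓ : ℕ, (ℓ : ℝ) * reg.a k ≤ K₁ * (1 + |Real.log (reg.a k)|) ∧ ∀ S : ℕ, reg.L k ≤ S →
    ∀ (f : Fin Nf) (t : ℕ), ℓ ≤ t → 2 * t ≤ S →
      apMoment (reg.β k) S (fun fl => reg.mcrit k + reg.a k * m fl / reg.Zm k) s f (Pi.single 0 ((t : ℕ) : ℤ)) ≤ C₂ * Real.exp (-(δ * (reg.a k * t))) + C₂ * Real.exp (-(δ₁ * (reg.a k * S)))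

/-- INWARD DECAY along `reg` (output of the sandwich): the antiperiodic `s`-moment decays from the origin on, at every
time-like endpoint inside half the volume, with `k`- and volume-uniform constants. -/
def InwardAlong {Nf : ℕ} (reg : QCDRegularisation Nf) (m : Fin Nf → ℝ) (s C₃ δ₃ : ℝ) : Prop :=
  ∀ᶠ k in atTop, ∀ S : ℕ, reg.L k ≤ S → ∀ (f : Fin Nf) (v : Literature.Probability.LatticeModels.Site 4), v ∈ box 4 S → 2 * ‖v‖ ≤ (S : ℝ) →
    ((|v 0| : ℤ) : ℝ) = ‖v‖ → apMoment (reg.β k) S (fun fl => reg.mcrit k + reg.a k * m fl / reg.Zm k) s f v ≤ C₃ * Real.exp (-(δ₃ * (reg.a k * ‖v‖)))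

/-- The crux re-read through the packaging (definitional): `K1 → K3 → ∀ N_f reg m > 0, Input → Concl`. -/
theorem fmClosure_iff :
    Summit.QuantumFields.QCD.Theses.PauliWegnerSea.FMClosureUnquenched ↔
      (Summit.QuantumFields.QCD.Theses.PauliWegnerSea.FibreCofactorDomination →
        Summit.QuantumFields.QCD.Theses.PauliWegnerSea.TiltedFlatness →
          ∀ (Nf : ℕ) (reg : QCDRegularisation Nf) (m : Fin Nf → ℝ), (∀ f, 0 < m f) → Input reg m → Concl reg m) :=
  Iff.rfl

/-! ### §1 Registered stubs -/

/-- **OUTWARD HALF** (`K1 → K3 → one-scale input ⇒ decay beyond a logarithmic threshold`, A6's second reading of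
(ii)): the Aizenman–Schenker–Friedrich–Hundertmark bootstrap run OUTWARD from the input shell — a-priori bound and
decoupling on two-star fibres (K1 + K3), independence replaced by far-conditioning stability / collar factorisation —
with ONE `k`- and volume-uniform prefactor (rate halved to absorb `1/b_k`; the local in-window count, A7, is part of
the burden).  This is the target of the outward lines (`thick-collar-far-stability`, `sea-factorises-across-collars`)
and is CONSUMED here; it inherits the crux's A5 corner (`ℓ₀ = 1`, `β_k = 0`) unchanged.  Size XL (open).
Leans on: route items `FibreCofactorDomination`, `TiltedFlatness` (hypotheses), `AizenmanEtAl2001` Thm 1/2,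
Disproof §6 `outward_bootstrap`. -/
theorem stub_outward :
    Summit.QuantumFields.QCD.Theses.PauliWegnerSea.FibreCofactorDomination →
      Summit.QuantumFields.QCD.Theses.PauliWegnerSea.TiltedFlatness →
      ∀ (Nf : ℕ) (reg : QCDRegularisation Nf) (m : Fin Nf → ℝ), (∀ f, 0 < m f) → Input reg m → Outward reg m := by
  sorry

/-- **PION OPERATOR BOUND** (card `PionOperatorBound`; the line's distinctive a-priori input, answers A7): for paired
bare masses `≥ -1 + η` (`κ ≤ κ(η) < 1/6`) and `β ≥ 0` the antiperiodic phase-quenched SECOND moment — the honest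
charged-pion correlator `Tr(𝕋^(N-t) X 𝕋^t X†)/Tr 𝕋^N` — is bounded by ONE constant `A(η, N_f)` for all volumes,
couplings, flavours and endpoints: `F(t) = Tr(𝕋^(N-t) X 𝕋^t X†)/Z` is symmetric log-convex on `[0,N]`, so
`F ≤ F(0) = Tr(𝕋^N X X†)/Z ≤ ‖X‖²`, and `‖X‖ ≤ c ‖B^(-1/2)‖² ≤ c/(1 - 6κ)` from Lüscher's equal-time dictionary
(triage r1-2: NOT via `Tr(APBP†) ≤ ‖P‖² Tr(AB)`, which is false).  Heavy masses (`m₀ > 2`, `κ < 1/12`) are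
deterministic (Neumann series `‖G‖ ≤ 3/(m₀+4)`).  Size L (the transfer-matrix formalism for Wilson lattice QCD is not
in the tree; `QCDSiteReflectionPositivity` is only a predicate).  Leans on: `Luscher1977` §3, `MontvayMunster1994`
§4.2.3–4.2.4 ((4.99)–(4.115)), tree `diracMatrixAP`, `qcdTorusExpectAP`, `wilsonDirac_gammaFive_hermitian_holds`,
`fermionDet_wilsonDirac_im_holds`, `WilsonDeterminantMassSplitting_holds`. -/
theorem stub_pionApriori :
    ∀ (Nf : ℕ) (η : ℝ), 0 < η → ∃ A : ℝ, ∀ (β : ℝ), 0 ≤ β → ∀ (mq : Fin Nf → ℝ), Paired mq → (∀ f, -1 + η ≤ mq f) →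
      ∀ (S : ℕ), 1 ≤ S → ∀ (f : Fin Nf) (v : Literature.Probability.LatticeModels.Site 4), v ∈ box 4 S → apMoment β S mq 2 f v ≤ A := by
  sorry

/-- **PION AXIS LOG-CONVEXITY + DOMINATION** (card `PionAxisLogConvex`, = ideator 1's `AntiperiodicPionLogConvex`
restated over the tree's `diracMatrixAP`, triage sharpen r1-1): for paired masses `> -1`, `β ≥ 0`, on the torus of
side `2S+1` with the antipodal antiperiodic layer, the second moment `π(v) = apMoment β S mq 2 f v` satisfies
(a) `π(t e₀)² ≤ π((t-1)e₀) π((t+1)e₀)` for `2 ≤ t ≤ 2S-1` (`π(t e₀) = Σ_ij |X_ij|² λ_i^(N-t) λ_j^t / Z`, `λ ≥ 0`: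
a positive combination of log-linear sequences; contact range `t ≤ 1` excluded), and (b) `π(v) ≤ π(|v₀| e₀)` for every
`v` in the box with `1 ≤ |v₀|` (Cauchy–Schwarz for the positive-semidefinite Hermitian pairing
`(X,Y) ↦ Tr(𝕋^(N-t) X 𝕋^t Y†)`, `1 ≤ t ≤ N-1`, spatial translation invariance, and `v ↦ -v` symmetry, which holds
configuration-wise: `Σ|G(0,-v)|² = Σ|G(v,0)|² = Σ|γ₅ G(0,v)† γ₅|² = Σ|G(0,v)|²`).  Gen-2 guard `1 ≤ |v₀|`: the
equal-time slice is excluded because the representation of the correlator as that pairing is the one between DISTINCT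
time slices (Wilson fermions: the time-zero bilinear `ψ̄γ₅ψ` straddles the two half-algebras of the site reflection,
cf. the tree predicate `QCDSiteReflectionPositivity`, slices `1 … ⌊S/2⌋`), and because the sandwich only dominates
time-like endpoints `|v₀| = ‖v‖ ≥ 1`.  Numerically confirmed free-field (triage r1-1 App. A / r1-3 (A): AP defect
`+0.14…+1.12` on `2 ≤ t ≤ N-2`, `N ≤ 15`, all `m₀ > -1`; domination ratio `≤ 0.49` for `t ≥ 1`; the PERIODIC functional
fails both — B1 — which is why the seam stub exists).  Size L (shares the transfer-matrix infrastructure with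
`stub_pionApriori`; (a)(b) need only `𝕋 ≥ 0`, i.e. site- and link-reflection positivity, `MontvayMunster1994`
(4.111)).  Leans on: as `stub_pionApriori`; Mathlib `inner_mul_le_norm_mul_norm`. -/
theorem stub_pionSpectral :
    ∀ (Nf : ℕ) (β : ℝ), 0 ≤ β → ∀ (mq : Fin Nf → ℝ), Paired mq → (∀ f, -1 < mq f) → ∀ (S : ℕ), 1 ≤ S → ∀ f : Fin Nf,
      (∀ t : ℕ, 2 ≤ t → t + 2 ≤ 2 * S + 1 →
        apMoment β S mq 2 f (Pi.single 0 ((t : ℕ) : ℤ)) ^ 2 ≤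
          apMoment β S mq 2 f (Pi.single 0 ((t - 1 : ℕ) : ℤ)) * apMoment β S mq 2 f (Pi.single 0 ((t + 1 : ℕ) : ℤ))) ∧
      (∀ v : Literature.Probability.LatticeModels.Site 4, v ∈ box 4 S → 1 ≤ |v 0| → apMoment β S mq 2 f v ≤ apMoment β S mq 2 f (Pi.single 0 |v 0|)) := by
  sorry

/-- **TILTED HIGHER MOMENT** (the sea buys `2+ε` moments on the paired locus, B2; the Hölder ceiling of the sandwich):
for paired masses `≥ -1+η`, `β ≥ 0`, the antiperiodic `(2+ε)`-moment of `Σ|G_f(0,v)|` is a genuine integral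
(`Y^(2+ε) det_f² Π'' = ‖adj_f‖^(2+ε) |det_f|^(-ε) Π''`, `ε` below the log-canonical threshold of the band-limited
determinant) and is bounded by `C (1+β)^p (2S+1)^p` — POLYNOMIAL volume dependence is allowed (it is absorbed by
`stub_inwardSandwich`, which slides the anchor outwards).  Two routes.  (i) K1-FREE (gen 2, recommended first): every
entry of the `(0,v)` block is at most `‖D_f⁻¹‖ = 1/σ_min(D_f(U))`, so `Y ≤ 144/σ_min` and
`apMoment (2+ε) ≤ 144^(2+ε) E_ν[σ_min^(-(2+ε))]` with `ν ∝ det_f det_f' Π'' dμ_W = det_f² Π'' dμ_W` the HONEST paired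
measure; since `det_f² = Π_i σ_i²` the weight itself cancels the two lowest powers, and by the layer-cake formula the
stub follows from the spectral small-ball (Wegner-type) bound `ν(σ_min(D_f) < t) ≤ C (1+β)^p (2S+1)^p t^(2+c)` for
some `c > ε` — a GLOBAL statement in which polynomial volume loss is harmless, in the class of K3(b′) (relative small
balls of band-limited link polynomials, iterated over fibres; free check: the AP Matsubara gap `π/(2S+1)` keeps
`σ_min ≳ 1/S` at `U = 1` for every mass `≥ -1+η`), with NO cofactor domination.  (ii) The antiperiodic twin of the
route's layer-2 `AprioriBound`: K1-type two-star cofactor domination with the GLOBAL in-window count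
(`n_w ≤ 12(2S+1)⁴` suffices here) plus K3(a)/(b′) under the star-conditional law tilted by the other flavours — but
note that the route items themselves do not apply verbatim (`diracMatrixAP U` is `diracMatrix` of a `U(3)`-valued field:
the seam sign `-1 ∉ SU(3)` is a `U(1)` holonomy no `SU(3)` refit or site-phase conjugation removes), so route (ii)
silently re-proves the open rank-2 crux K1 in U(3) dress; prefer (i).  Heavy masses deterministic (Neumann series).
Size L.  Leans on: `PauliBandLimit`, `CarberyWright2001`, von-mises-circles (restricted small balls), the mechanism of
`TiltedFlatness` (b′); tree `Literature.Barriers.QuantumFields.norm_entry_le_l2_opNorm` (`‖A i j‖ ≤ ‖A‖`, stated for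
`Fin N`-indexed matrices — reindex), Mathlib's layer-cake formula `MeasureTheory.lintegral_rpow_eq_lintegral_meas_lt_mul`. -/
theorem stub_tiltedMoment :
    ∀ (Nf : ℕ) (η : ℝ), 0 < η → ∃ ε p C : ℝ, 0 < ε ∧ 0 < C ∧ ∀ (β : ℝ), 0 ≤ β → ∀ (mq : Fin Nf → ℝ), Paired mq →
      (∀ f, -1 + η ≤ mq f) → ∀ (S : ℕ), 1 ≤ S → ∀ (f : Fin Nf) (v : Literature.Probability.LatticeModels.Site 4), v ∈ box 4 S →
        Integrable (fun U : GaugeConfig 4 (2 * S + 1) (Matrix.specialUnitaryGroup (Fin 3) ℂ) => ‖(diracMatrixAP U mq).det‖ * (∑ a : Fin 3, ∑ i : Fin 4, ∑ b : Fin 3, ∑ j : Fin 4, ‖(diracMatrixAP U mq)⁻¹ (quarkEquiv (f, (Torus.proj (2 * S + 1) 0, a, i))) (quarkEquiv (f, (Torus.proj (2 * S + 1) v, b, j)))‖) ^ (2 + ε)) (wilsonMeasure (fundamentalRep (Fin 3)) β) ∧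
        apMoment β S mq (2 + ε) f v ≤ C * (1 + β) ^ p * ((2 * S + 1 : ℕ) : ℝ) ^ p := by
  sorry

/-- **SEAM** (periodic statement tori ↔ antiperiodic positivity tori; ideator 1's `(-1)^F` bookkeeping made a stub,
with the cubic symmetry of the periodic ensemble folded in): on the RP locus, given outward decay, (1) `SeamNear`: for
endpoints inside half the volume the periodic `s`-moment is at most `C₁ ×` the antiperiodic one at a TIME-LIKE point of
the same sup-norm (coordinate permutation — an exact symmetry of the periodic functional — then
`D_per = D_AP + 2H_seam`, `G_per - G_AP = -G_AP (2H_seam) G_per` and `|det D_per / det D_AP|` = odd-winding loops of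
length `≥ 2S+1`: paths through the antipodal layer at time `±S ≥ L_k` are outward-scale, their `(2S+1)³` entropy is
paid by `LargeVolume` + `TameCoupling`) plus `C₁ exp(-δ₁ a_k S)`; (2) `FarAxisAlong`: the same comparison in the other
direction ON THE AXIS turns `OutwardWith` into antiperiodic smallness for `ℓ(k) ≤ t ≤ S/2`.  Why it might fail:
configuration-wise the ratio `(det_per/det_AP)²` is unbounded (near-real modes), so the comparison must be done in the
tilted mean with OUT-type averaged decay — a finite-size/boundary-condition estimate for the MEASURE, not only for
propagators.  Size L.  Leans on: `OutwardWith` (hypothesis), tree `apLinkSign` / `wilsonDiracAP`,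
`wilsonMeasure_map_gaugeTransform_holds`, `HoppingExpansionLocality_holds` (heavy corner), `MontvayMunster1994`
(4.34). -/
theorem stub_seam :
    ∀ (Nf : ℕ) (reg : QCDRegularisation Nf) (m : Fin Nf → ℝ), (∀ f, 0 < m f) → RPLocus reg m →
      ∀ (s δ C K₁ : ℝ), 0 < s → s < 1 → 0 < δ → 0 < C → OutwardWith reg m s δ C K₁ →
        ∃ C₁ δ₁ : ℝ, 0 < C₁ ∧ 0 < δ₁ ∧ SeamNear reg m s C₁ δ₁ ∧ FarAxisAlong reg m s δ C₁ δ₁ K₁ := by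
  sorry

/-- **INWARD SANDWICH** (the interpolation theorem of the line; answers A6/B0 on the RP locus): from the a-priori bound
`π ≤ A`, axis log-convexity + domination, the polynomial `(2+ε)`-moment bound and far-axis smallness, the antiperiodic
`s`-moment decays from the origin on at every time-like endpoint inside half the volume, with `k`-, `S`-uniform
`C₃, δ₃`.  Proof sketch (all classical, size M): Jensen `E Y^s ≤ 12^s π^(s/2)`; domination `π(v) ≤ π(|v₀|e₀)`;
Hölder `π ≤ (E Y^s)^θ (E Y^(2+ε))^(1-θ)`, `θ = ε/(2+ε-s)`, fed by `FarAxisAlong` ON THE AXIS; the polynomial loss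
`(Cm (1+β_k)^p (2S+1)^p)^(1-θ)` is paid by HALF the far-axis rate from the anchor
`t⋆ = max(ℓ, ⌈c (log(2S+1) + log(1+β_k) + c') / (θ δ a_k)⌉)` on, and `2 t⋆ ≤ S` for every `S ≥ L_k` eventually
(room from `LargeVolume`: `a_k S ≥ a_k L_k ≫ |log a_k| ≥` both `a_k ℓ(k)/K₁` and, by `TameCoupling`, `log(1+β_k)`;
and `a_k S ≫ log S` on `S ≥ L_k`).  Two regimes for the axis point `n = |v₀| = ‖v‖ ≤ S/2`: (i) `n ≥ t⋆`: Hölder at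
`n` itself gives `π(n e₀) ≤ (2C₂)^θ exp(-θ δ' a_k n / 2)`, `δ' = min δ δ₁`; (ii) `n ≤ t⋆`: discrete log-convexity on the
indices `1 … N-1` interpolates `log π` linearly between `t = 1` (`π ≤ A`) and `t⋆` (small by (i)):
`π(n e₀) ≤ max(A,1) exp(-θ δ' a_k (n-1) / 2)`.  Then domination and Jensen; same `s` throughout (no moment
monotonicity needed); `a_k ≤ 1` eventually absorbs the shift by `1`.  Leans on: Mathlib `ConvexOn`,
`MeasureTheory.integral_mul_le_Lp_mul_Lq_of_nonneg` (Hölder), `ConvexOn.map_integral_le` (Jensen),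
`Real.add_pow_le_pow_mul_pow_of_add_eq_one`; integrability of the tilted integrands (continuous on a compact
configuration space; the `(2+ε)` one is supplied by `MomentAlong`). -/
theorem stub_inwardSandwich :
    ∀ (Nf : ℕ) (reg : QCDRegularisation Nf) (m : Fin Nf → ℝ), Paired m → TameCoupling reg → LargeVolume reg →
      ∀ (s : ℝ), 0 < s → s < 1 → ∀ (A ε p Cm : ℝ), 0 < ε →
        AprioriAlong reg m A → SpectralAlong reg m → MomentAlong reg m ε p Cm →
        ∀ (δ C₂ δ₁ K₁ : ℝ), 0 < δ → 0 < C₂ → 0 < δ₁ → FarAxisAlong reg m s δ C₂ δ₁ K₁ →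
          ∃ C₃ δ₃ : ℝ, 0 < C₃ ∧ 0 < δ₃ ∧ InwardAlong reg m s C₃ δ₃ := by
  sorry

/-- **DECLARED GAP — inward step OFF the reflection-positive locus** (odd `N_f` / unpaired masses — rooted weight
`|det D_f|`, no transfer matrix, B1(b); masses `≤ -1` infinitely often — outside Lüscher's domain, doublers/Aoki;
`β_k < 0` or `β_k ≫ log(1/a_k)`; volumes with `a_k L_k = O(log(1/a_k))`): the crux restricted to `¬ RPLocus`, GIVEN
the outward half.  NOT CLAIMED by this line and not attacked by it: no inward interpolation principle is known for
non-reflection-positive flavour content (B0 + B1, Disproof §5), and without one the typed `k`-uniform `C` from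
`‖v‖ = 0` on is out of reach of every card of round 1 (all three triage reports).  Registered so that the skeleton
reaches the crux AS TYPED and so that the gap is ONE named obligation on the item; it becomes vacuous under either
route-level repair on record (A6: (ii) restated to `‖v‖ ≥ ℓ(k)` / with `C (1+β_k)^p a_k^(-p)`; or K2's range
restricted to the regularisation `OneScaleTrajectory` produces, with (ii) asked on the RP locus).  The `N_f = 3`
instance used by `closes` sits here.  Size: open-problem. -/
theorem stub_inwardOffLocus :
    Summit.QuantumFields.QCD.Theses.PauliWegnerSea.FibreCofactorDomination →
      Summit.QuantumFields.QCD.Theses.PauliWegnerSea.TiltedFlatness →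
      ∀ (Nf : ℕ) (reg : QCDRegularisation Nf) (m : Fin Nf → ℝ), (∀ f, 0 < m f) → ¬ RPLocus reg m →
        Input reg m → Outward reg m → Concl reg m := by
  sorry

/-! ### §2 Composition (no `sorry` below this line) -/

/-- Monotonicity of the decay profile in the rate. -/
theorem exp_rate_mono {δ δ' x : ℝ} (h : δ' ≤ δ) (hx : 0 ≤ x) :
    Real.exp (-(δ * x)) ≤ Real.exp (-(δ' * x)) :=
  Real.exp_le_exp.mpr (neg_le_neg (mul_le_mul_of_nonneg_right h hx))

/-- **The positivity branch** (sorry-free logic): on the reflection-positive locus, the outward half and the five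
positivity/seam/sandwich statements give clause (ii) with `δ_fin = min δ (min δ₁ δ₃)`, `C_fin = C + C₁C₃ + C₁`. -/
theorem concl_of_rpLocus {Nf : ℕ} (reg : QCDRegularisation Nf) (m : Fin Nf → ℝ)
    (h₂ : ∀ (Nf : ℕ) (η : ℝ), 0 < η → ∃ A : ℝ, ∀ (β : ℝ), 0 ≤ β → ∀ (mq : Fin Nf → ℝ), Paired mq → (∀ f, -1 + η ≤ mq f) →
      ∀ (S : ℕ), 1 ≤ S → ∀ (f : Fin Nf) (v : Literature.Probability.LatticeModels.Site 4), v ∈ box 4 S → apMoment β S mq 2 f v ≤ A)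
    (h₃ : ∀ (Nf : ℕ) (β : ℝ), 0 ≤ β → ∀ (mq : Fin Nf → ℝ), Paired mq → (∀ f, -1 < mq f) → ∀ (S : ℕ), 1 ≤ S → ∀ f : Fin Nf,
      (∀ t : ℕ, 2 ≤ t → t + 2 ≤ 2 * S + 1 →
        apMoment β S mq 2 f (Pi.single 0 ((t : ℕ) : ℤ)) ^ 2 ≤
          apMoment β S mq 2 f (Pi.single 0 ((t - 1 : ℕ) : ℤ)) * apMoment β S mq 2 f (Pi.single 0 ((t + 1 : ℕ) : ℤ))) ∧
      (∀ v : Literature.Probability.LatticeModels.Site 4, v ∈ box 4 S → 1 ≤ |v 0| → apMoment β S mq 2 f v ≤ apMoment β S mq 2 f (Pi.single 0 |v 0|)))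
    (h₄ : ∀ (Nf : ℕ) (η : ℝ), 0 < η → ∃ ε p C : ℝ, 0 < ε ∧ 0 < C ∧ ∀ (β : ℝ), 0 ≤ β → ∀ (mq : Fin Nf → ℝ), Paired mq →
      (∀ f, -1 + η ≤ mq f) → ∀ (S : ℕ), 1 ≤ S → ∀ (f : Fin Nf) (v : Literature.Probability.LatticeModels.Site 4), v ∈ box 4 S →
        Integrable (fun U : GaugeConfig 4 (2 * S + 1) (Matrix.specialUnitaryGroup (Fin 3) ℂ) => ‖(diracMatrixAP U mq).det‖ * (∑ a : Fin 3, ∑ i : Fin 4, ∑ b : Fin 3, ∑ j : Fin 4, ‖(diracMatrixAP U mq)⁻¹ (quarkEquiv (f, (Torus.proj (2 * S + 1) 0, a, i))) (quarkEquiv (f, (Torus.proj (2 * S + 1) v, b, j)))‖) ^ (2 + ε)) (wilsonMeasure (fundamentalRep (Fin 3)) β) ∧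
        apMoment β S mq (2 + ε) f v ≤ C * (1 + β) ^ p * ((2 * S + 1 : ℕ) : ℝ) ^ p)
    (h₅ : ∀ (Nf : ℕ) (reg : QCDRegularisation Nf) (m : Fin Nf → ℝ), (∀ f, 0 < m f) → RPLocus reg m →
      ∀ (s δ C K₁ : ℝ), 0 < s → s < 1 → 0 < δ → 0 < C → OutwardWith reg m s δ C K₁ →
        ∃ C₁ δ₁ : ℝ, 0 < C₁ ∧ 0 < δ₁ ∧ SeamNear reg m s C₁ δ₁ ∧ FarAxisAlong reg m s δ C₁ δ₁ K₁)
    (h₆ : ∀ (Nf : ℕ) (reg : QCDRegularisation Nf) (m : Fin Nf → ℝ), Paired m → TameCoupling reg → LargeVolume reg →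
      ∀ (s : ℝ), 0 < s → s < 1 → ∀ (A ε p Cm : ℝ), 0 < ε →
        AprioriAlong reg m A → SpectralAlong reg m → MomentAlong reg m ε p Cm →
        ∀ (δ C₂ δ₁ K₁ : ℝ), 0 < δ → 0 < C₂ → 0 < δ₁ → FarAxisAlong reg m s δ C₂ δ₁ K₁ →
          ∃ C₃ δ₃ : ℝ, 0 < C₃ ∧ 0 < δ₃ ∧ InwardAlong reg m s C₃ δ₃)
    (hm : ∀ f, 0 < m f) (hH : RPLocus reg m) (hout : Outward reg m) : Concl reg m := by
  obtain ⟨hpair, ⟨η, hη, hmass⟩, htame, hvol⟩ := hH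
  obtain ⟨s, δ, C, K₁, hs, hs1, hδ, hC, hOW⟩ := hout
  obtain ⟨A, hA⟩ := h₂ Nf η hη
  obtain ⟨ε, p, Cm, hε, hCm, hM⟩ := h₄ Nf η hη
  obtain ⟨σ, hσ₁, hσ₂, hσ₃⟩ := hpair
  obtain ⟨B₀, hB⟩ := htame
  -- the bare tuple along `reg` is paired at every step
  have hpairk : ∀ k : ℕ, Paired (fun fl => reg.mcrit k + reg.a k * m fl / reg.Zm k) :=
    fun k => ⟨σ, hσ₁, hσ₂, fun f => by simp only [hσ₃ f]⟩
  -- eventually all flavours are inside the mass window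
  have hmass' : ∀ᶠ k in atTop, ∀ f : Fin Nf, -1 + η ≤ reg.mcrit k + reg.a k * m f / reg.Zm k :=
    Filter.eventually_all.mpr hmass
  -- the three positivity inputs along `reg`
  have hApr : AprioriAlong reg m A := by
    unfold AprioriAlong
    filter_upwards [hB, hmass'] with k hk hmk
    exact fun S hS f v hv => hA (reg.β k) hk.1 _ (hpairk k) hmk S hS f v hv
  have hSpec : SpectralAlong reg m := by
    unfold SpectralAlong
    filter_upwards [hB, hmass'] with k hk hmk
    exact fun S hS f => h₃ Nf (reg.β k) hk.1 _ (hpairk k) (fun f => by linarith [hmk f]) S hS f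
  have hMom : MomentAlong reg m ε p Cm := by
    unfold MomentAlong
    filter_upwards [hB, hmass'] with k hk hmk
    exact fun S hS f v hv => hM (reg.β k) hk.1 _ (hpairk k) hmk S hS f v hv
  -- seam and sandwich
  obtain ⟨C₁, δ₁, hC₁, hδ₁, hNear, hFar⟩ :=
    h₅ Nf reg m hm ⟨⟨σ, hσ₁, hσ₂, hσ₃⟩, ⟨η, hη, hmass⟩, ⟨B₀, hB⟩, hvol⟩ s δ C K₁ hs hs1 hδ hC hOW
  obtain ⟨C₃, δ₃, hC₃, hδ₃, hIn⟩ :=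
    h₆ Nf reg m ⟨σ, hσ₁, hσ₂, hσ₃⟩ ⟨B₀, hB⟩ hvol s hs hs1 A ε p Cm hε hApr hSpec hMom δ C₁ δ₁ K₁ hδ hC₁ hδ₁ hFar
  -- assemble clause (ii)
  refine ⟨s, min δ (min δ₁ δ₃), C + (C₁ * C₃ + C₁), hs, hs1, lt_min hδ (lt_min hδ₁ hδ₃), ?_⟩
  have hvol' : ∀ᶠ k in atTop, 2 * K₁ ≤ reg.a k * reg.L k / (1 + |Real.log (reg.a k)|) :=
    hvol.eventually_ge_atTop _
  have hd₀ : min δ (min δ₁ δ₃) ≤ δ := min_le_left _ _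
  have hd₁ : min δ (min δ₁ δ₃) ≤ δ₁ := (min_le_right _ _).trans (min_le_left _ _)
  have hd₃ : min δ (min δ₁ δ₃) ≤ δ₃ := (min_le_right _ _).trans (min_le_right _ _)
  have hCC : 0 ≤ C₁ * C₃ + C₁ := by positivity
  unfold OutwardWith at hOW
  unfold SeamNear at hNear
  unfold InwardAlong at hIn
  filter_upwards [hOW, hNear, hIn, hvol'] with k hOk hNk hIk hVk S hS f v hv
  obtain ⟨ℓ, hℓ, hOk⟩ := hOk
  have hx0 : 0 ≤ reg.a k * ‖v‖ := mul_nonneg (reg.a_pos k).le (norm_nonneg _)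
  have hE0 : 0 ≤ Real.exp (-(min δ (min δ₁ δ₃) * (reg.a k * ‖v‖))) := (Real.exp_pos _).le
  rcases le_or_gt (ℓ : ℝ) ‖v‖ with hfar | hnear
  · -- outward region: the outward half as is
    calc perMoment (reg.β k) S (fun fl => reg.mcrit k + reg.a k * m fl / reg.Zm k) s f v
        ≤ C * Real.exp (-(δ * (reg.a k * ‖v‖))) := hOk S hS f v hv hfar
      _ ≤ C * Real.exp (-(min δ (min δ₁ δ₃) * (reg.a k * ‖v‖))) :=
          mul_le_mul_of_nonneg_left (exp_rate_mono hd₀ hx0) hC.le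
      _ ≤ (C + (C₁ * C₃ + C₁)) * Real.exp (-(min δ (min δ₁ δ₃) * (reg.a k * ‖v‖))) :=
          mul_le_mul_of_nonneg_right (le_add_of_nonneg_right hCC) hE0
  · -- inward region: the endpoint lies inside half the volume (large-volume clause) …
    have h1 : 0 < 1 + |Real.log (reg.a k)| := by positivity
    have h2 : 2 * K₁ * (1 + |Real.log (reg.a k)|) ≤ reg.a k * reg.L k := (le_div_iff₀ h1).mp hVk
    have h3 : reg.a k * (2 * (ℓ : ℝ)) ≤ reg.a k * (reg.L k : ℝ) := by
      calc reg.a k * (2 * (ℓ : ℝ)) = 2 * ((ℓ : ℝ) * reg.a k) := by ring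
        _ ≤ 2 * (K₁ * (1 + |Real.log (reg.a k)|)) := by linarith [hℓ]
        _ = 2 * K₁ * (1 + |Real.log (reg.a k)|) := by ring
        _ ≤ reg.a k * (reg.L k : ℝ) := h2
    have h4 : 2 * (ℓ : ℝ) ≤ (reg.L k : ℝ) := le_of_mul_le_mul_left h3 (reg.a_pos k)
    have h5 : (reg.L k : ℝ) ≤ (S : ℝ) := by exact_mod_cast hS
    have h2S : 2 * ‖v‖ ≤ (S : ℝ) := by linarith
    have hvS : ‖v‖ ≤ (S : ℝ) := by linarith [norm_nonneg v]
    -- … so the seam and the inward sandwich apply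
    obtain ⟨v', hv', hnorm, htl, hle⟩ := hNk S hS f v hv h2S
    have h2S' : 2 * ‖v'‖ ≤ (S : ℝ) := by rw [hnorm]; exact h2S
    have hI := hIk S hS f v' hv' h2S' htl
    rw [hnorm] at hI
    have e1 : Real.exp (-(δ₁ * (reg.a k * S))) ≤ Real.exp (-(min δ (min δ₁ δ₃) * (reg.a k * ‖v‖))) :=
      calc Real.exp (-(δ₁ * (reg.a k * S)))
          ≤ Real.exp (-(δ₁ * (reg.a k * ‖v‖))) :=
            Real.exp_le_exp.mpr (neg_le_neg (mul_le_mul_of_nonneg_left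
              (mul_le_mul_of_nonneg_left hvS (reg.a_pos k).le) hδ₁.le))
        _ ≤ Real.exp (-(min δ (min δ₁ δ₃) * (reg.a k * ‖v‖))) := exp_rate_mono hd₁ hx0
    have e3 : Real.exp (-(δ₃ * (reg.a k * ‖v‖))) ≤ Real.exp (-(min δ (min δ₁ δ₃) * (reg.a k * ‖v‖))) :=
      exp_rate_mono hd₃ hx0
    calc perMoment (reg.β k) S (fun fl => reg.mcrit k + reg.a k * m fl / reg.Zm k) s f v
        ≤ C₁ * apMoment (reg.β k) S (fun fl => reg.mcrit k + reg.a k * m fl / reg.Zm k) s f v' + C₁ * Real.exp (-(δ₁ * (reg.a k * S))) := hle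
      _ ≤ C₁ * (C₃ * Real.exp (-(δ₃ * (reg.a k * ‖v‖)))) + C₁ * Real.exp (-(δ₁ * (reg.a k * S))) :=
          add_le_add (mul_le_mul_of_nonneg_left hI hC₁.le) le_rfl
      _ ≤ C₁ * (C₃ * Real.exp (-(min δ (min δ₁ δ₃) * (reg.a k * ‖v‖)))) +
            C₁ * Real.exp (-(min δ (min δ₁ δ₃) * (reg.a k * ‖v‖))) :=
          add_le_add (mul_le_mul_of_nonneg_left (mul_le_mul_of_nonneg_left e3 hC₃.le) hC₁.le)
            (mul_le_mul_of_nonneg_left e1 hC₁.le)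
      _ = (C₁ * C₃ + C₁) * Real.exp (-(min δ (min δ₁ δ₃) * (reg.a k * ‖v‖))) := by ring
      _ ≤ (C + (C₁ * C₃ + C₁)) * Real.exp (-(min δ (min δ₁ δ₃) * (reg.a k * ‖v‖))) :=
          mul_le_mul_of_nonneg_right (le_add_of_nonneg_left hC.le) hE0

/-- **The logic of the line is closed**: the seven stub STATEMENTS imply the crux (read through `fmClosure_iff`),
by cases on the reflection-positive locus. -/
theorem composition_closed
    (h₁ : Summit.QuantumFields.QCD.Theses.PauliWegnerSea.FibreCofactorDomination →
      Summit.QuantumFields.QCD.Theses.PauliWegnerSea.TiltedFlatness →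
      ∀ (Nf : ℕ) (reg : QCDRegularisation Nf) (m : Fin Nf → ℝ), (∀ f, 0 < m f) → Input reg m → Outward reg m)
    (h₂ : ∀ (Nf : ℕ) (η : ℝ), 0 < η → ∃ A : ℝ, ∀ (β : ℝ), 0 ≤ β → ∀ (mq : Fin Nf → ℝ), Paired mq → (∀ f, -1 + η ≤ mq f) →
      ∀ (S : ℕ), 1 ≤ S → ∀ (f : Fin Nf) (v : Literature.Probability.LatticeModels.Site 4), v ∈ box 4 S → apMoment β S mq 2 f v ≤ A)
    (h₃ : ∀ (Nf : ℕ) (β : ℝ), 0 ≤ β → ∀ (mq : Fin Nf → ℝ), Paired mq → (∀ f, -1 < mq f) → ∀ (S : ℕ), 1 ≤ S → ∀ f : Fin Nf,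
      (∀ t : ℕ, 2 ≤ t → t + 2 ≤ 2 * S + 1 →
        apMoment β S mq 2 f (Pi.single 0 ((t : ℕ) : ℤ)) ^ 2 ≤
          apMoment β S mq 2 f (Pi.single 0 ((t - 1 : ℕ) : ℤ)) * apMoment β S mq 2 f (Pi.single 0 ((t + 1 : ℕ) : ℤ))) ∧
      (∀ v : Literature.Probability.LatticeModels.Site 4, v ∈ box 4 S → 1 ≤ |v 0| → apMoment β S mq 2 f v ≤ apMoment β S mq 2 f (Pi.single 0 |v 0|)))
    (h₄ : ∀ (Nf : ℕ) (η : ℝ), 0 < η → ∃ ε p C : ℝ, 0 < ε ∧ 0 < C ∧ ∀ (β : ℝ), 0 ≤ β → ∀ (mq : Fin Nf → ℝ), Paired mq →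
      (∀ f, -1 + η ≤ mq f) → ∀ (S : ℕ), 1 ≤ S → ∀ (f : Fin Nf) (v : Literature.Probability.LatticeModels.Site 4), v ∈ box 4 S →
        Integrable (fun U : GaugeConfig 4 (2 * S + 1) (Matrix.specialUnitaryGroup (Fin 3) ℂ) => ‖(diracMatrixAP U mq).det‖ * (∑ a : Fin 3, ∑ i : Fin 4, ∑ b : Fin 3, ∑ j : Fin 4, ‖(diracMatrixAP U mq)⁻¹ (quarkEquiv (f, (Torus.proj (2 * S + 1) 0, a, i))) (quarkEquiv (f, (Torus.proj (2 * S + 1) v, b, j)))‖) ^ (2 + ε)) (wilsonMeasure (fundamentalRep (Fin 3)) β) ∧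
        apMoment β S mq (2 + ε) f v ≤ C * (1 + β) ^ p * ((2 * S + 1 : ℕ) : ℝ) ^ p)
    (h₅ : ∀ (Nf : ℕ) (reg : QCDRegularisation Nf) (m : Fin Nf → ℝ), (∀ f, 0 < m f) → RPLocus reg m →
      ∀ (s δ C K₁ : ℝ), 0 < s → s < 1 → 0 < δ → 0 < C → OutwardWith reg m s δ C K₁ →
        ∃ C₁ δ₁ : ℝ, 0 < C₁ ∧ 0 < δ₁ ∧ SeamNear reg m s C₁ δ₁ ∧ FarAxisAlong reg m s δ C₁ δ₁ K₁)
    (h₆ : ∀ (Nf : ℕ) (reg : QCDRegularisation Nf) (m : Fin Nf → ℝ), Paired m → TameCoupling reg → LargeVolume reg →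
      ∀ (s : ℝ), 0 < s → s < 1 → ∀ (A ε p Cm : ℝ), 0 < ε →
        AprioriAlong reg m A → SpectralAlong reg m → MomentAlong reg m ε p Cm →
        ∀ (δ C₂ δ₁ K₁ : ℝ), 0 < δ → 0 < C₂ → 0 < δ₁ → FarAxisAlong reg m s δ C₂ δ₁ K₁ →
          ∃ C₃ δ₃ : ℝ, 0 < C₃ ∧ 0 < δ₃ ∧ InwardAlong reg m s C₃ δ₃)
    (h₇ : Summit.QuantumFields.QCD.Theses.PauliWegnerSea.FibreCofactorDomination →
      Summit.QuantumFields.QCD.Theses.PauliWegnerSea.TiltedFlatness →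
      ∀ (Nf : ℕ) (reg : QCDRegularisation Nf) (m : Fin Nf → ℝ), (∀ f, 0 < m f) → ¬ RPLocus reg m →
        Input reg m → Outward reg m → Concl reg m) :
    Summit.QuantumFields.QCD.Theses.PauliWegnerSea.FibreCofactorDomination →
      Summit.QuantumFields.QCD.Theses.PauliWegnerSea.TiltedFlatness →
        ∀ (Nf : ℕ) (reg : QCDRegularisation Nf) (m : Fin Nf → ℝ), (∀ f, 0 < m f) → Input reg m → Concl reg m := by
  intro hK1 hK3 Nf reg m hm hin
  classical
  have hout : Outward reg m := h₁ hK1 hK3 Nf reg m hm hin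
  by_cases hH : RPLocus reg m
  · exact concl_of_rpLocus reg m h₂ h₃ h₄ h₅ h₆ hm hH hout
  · exact h₇ hK1 hK3 Nf reg m hm hH hin hout

/-- **The skeleton IS the crux proof modulo the seven declared stubs**: `FMClosureUnquenched_of` concludes
`PauliWegnerSea.FMClosureUnquenched` BY NAME and uses exactly `stub_outward`, `stub_pionApriori`, `stub_pionSpectral`,
`stub_tiltedMoment`, `stub_seam`, `stub_inwardSandwich`, `stub_inwardOffLocus`. -/
theorem FMClosureUnquenched_of :
    Summit.QuantumFields.QCD.Theses.PauliWegnerSea.FMClosureUnquenched :=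
  fmClosure_iff.mpr
    (composition_closed stub_outward stub_pionApriori stub_pionSpectral stub_tiltedMoment stub_seam
      stub_inwardSandwich stub_inwardOffLocus)

end

end Summit.QuantumFields.QCD.Cruxes.FMClosureUnquenched.Gamma5SquarePositivity
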